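import Summits.Ventures.HodgeRepro2.T5BergmanUnitary
import Summits.Ventures.HodgeRepro2.T5BergmanLowestWeight
import Summits.Ventures.HodgeRepro2.T5SU11CoefficientPow

/-!
# The `L²`-integral of the lowest-weight matrix coefficient: Schur orthogonality with formal degree `2`

`T5BergmanCoefficient` gives `|⟨π₃(g) 1, 1⟩|² = (π/2)² (1 - |g·0|²)³ = (π/2)² · coeffSq g` for the
weight-`3` Bergman model; `T5SU11CoefficientL2` integrates `coeffSq` against every Haar measure of
`SU(1,1)` (`c • ∫_G coeffSq dμ = π/2`, `∫_G coeffSq dμ_R = ½` for Rühl's normalisation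
`μ_R = ν/π`).  Together: the matrix coefficient `g ↦ ⟨π₃(g) 1, 1⟩` is square-integrable against
every Haar measure, and

  `∫_G |⟨π₃(g) 1, 1⟩|² dμ_R = |⟨1, 1⟩|² / 2 = ‖1‖⁴ / d(π₃⁺)`,   `d(π₃⁺) = 2`,

the Schur orthogonality relation of S4 l. 83 («`∫_{H_j} |⟨π f, f⟩|² = ‖f‖⁴ · …`, `d(π₃⁺) = 2`») for
the explicit model and the explicit Haar measure `μ_R`.  Also: the constant function is a weight
vector of weight `k` for the rotation subgroup (`π_k(rot u) 1 = u^{-k} · 1`).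

Blind lane: Mathlib + the HodgeRepro2 prefix only; no sorry; axioms ⊆ {propext, Classical.choice,
Quot.sound}.
-/

namespace Summit.Ventures.HodgeRepro2.T5BergmanCoefficientL2

open MeasureTheory MeasureTheory.Measure Metric
open T5PoincareDensity T5SU11Unimodular T5SU11Fibration T5SU11FibrationHaar T5SU11FibrationCartan
  T5HaarCircle T5SU11CoefficientL2 T5SU11CoefficientPow T5BergmanCoefficient T5BergmanUnitary
  T5BergmanLowestWeight
open scoped Real

/-! ### The lowest-weight vector is a weight vector for `K` -/

/-- `π_k(rot u) 1 = u^{-k} · 1`: the constant function has `K`-weight `k` (the lowest weight of the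
model). -/
theorem act_rot_lowest (k : ℕ) (u : Circle) (z : ℂ) :
    act k (rot u) lowest z = ((u : ℂ)⁻¹) ^ k := by
  rw [act_rot]
  simp [lowest]

/-- **The `K`-types of the model**: the monomials are weight vectors, `π_k(rot u) zⁿ = u^{-(k+2n)} zⁿ`
— the rotation subgroup acts on `zⁿ` by the character `u ↦ u^{-(k+2n)}`, so the weights occurring
are `k, k+2, k+4, …`, all `≥ k`: «lowest weight `k`», attained exactly on the constants
(`T5BergmanLowestWeight.weight_iff_const`). -/
theorem act_rot_monomial (k n : ℕ) (u : Circle) (z : ℂ) :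
    act k (rot u) (fun w => w ^ n) z = ((u : ℂ)⁻¹) ^ (k + 2 * n) * z ^ n := by
  rw [act_rot]
  ring

/-! ### The coefficient function on `SU(1,1)` -/

/-- The lowest-weight matrix coefficient `g ↦ ⟨π₃(g) 1, 1⟩₃` of the weight-`3` model. -/
noncomputable def coeff (g : SU11) : ℂ := pairing 3 (act 3 g lowest) lowest

/-- `coeff g = a^{-3} · π/2` for `g = su11 a b`. -/
theorem coeff_eq (g : SU11) : coeff g = (mat g 0 0)⁻¹ ^ 3 * ((π / 2 : ℝ) : ℂ) := by
  rw [coeff, pairing_act_lowest, pairing_lowest_lowest_three]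

/-- **Bi-`K`-equivariance of the coefficient**: `coeff (rot u · g · rot v) = (u v)^{-3} coeff g` —
through the representation property, unitarity and `π₃(rot v) 1 = v^{-3} · 1`; so `|coeff|` is a
function on `K \ G / K`, i.e. of the Cartan coordinate `η` alone. -/
theorem coeff_rot_mul_rot (u v : Circle) (g : SU11) :
    coeff (rot u * g * rot v) = (((u : ℂ) * v)⁻¹) ^ 3 * coeff g := by
  unfold coeff
  rw [mul_assoc, pairing_act_mul, pairing_act_left 3 (by norm_num), pairing_act_mul]
  have h1 : ∀ z ∈ ball (0 : ℂ) 1, act 3 g (act 3 (rot v) lowest) z =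
      ((v : ℂ)⁻¹) ^ 3 * act 3 g lowest z := by
    intro z _
    show (denom (mat g⁻¹) z)⁻¹ ^ 3 * act 3 (rot v) lowest (mobius (mat g⁻¹) z) = _
    rw [act_rot_lowest, act_lowest_apply]
    ring
  have h2 : ∀ z ∈ ball (0 : ℂ) 1, act 3 (rot u)⁻¹ lowest z = ((u : ℂ)) ^ 3 * lowest z := by
    intro z _
    rw [← map_inv, act_rot_lowest, Circle.coe_inv, inv_inv]
    simp [lowest]
  rw [pairing_congr h1 h2, pairing_smul_left, pairing_smul_right, map_pow,
    ← Circle.coe_inv_eq_conj, Circle.coe_inv]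
  ring

/-- `|coeff g|² = (π/2)² · coeffSq g` — the coefficient squared IS (up to `‖1‖⁴`) the function
`coeffSq = (1 - |g·0|²)³` integrated in `T5SU11CoefficientL2`. -/
theorem norm_coeff_sq (g : SU11) : ‖coeff g‖ ^ 2 = (π / 2) ^ 2 * coeffSq g := by
  rw [coeff, norm_pairing_act_lowest_three_sq']
  rfl

/-- `|coeff g| ≤ π/2 = |⟨1, 1⟩|` (the coefficient is bounded by the norm squared, `|g·0| < 1`). -/
theorem norm_coeff_le (g : SU11) : ‖coeff g‖ ≤ π / 2 := by
  have h := norm_coeff_sq g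
  have h1 : coeffSq g ≤ 1 := by
    unfold coeffSq
    have h0 := norm_nonneg (orbit g)
    have h1 := mem_ball_zero_iff.mp (orbit_mem_ball g)
    exact pow_le_one₀ (by nlinarith) (by nlinarith)
  have h2 : ‖coeff g‖ ^ 2 ≤ (π / 2) ^ 2 := by
    rw [h]
    exact mul_le_of_le_one_right (by positivity) h1
  nlinarith [norm_nonneg (coeff g), Real.pi_pos, h2]

/-- `coeff` is continuous (the coefficient is a continuous function of `g`). -/
theorem continuous_coeff : Continuous coeff := by
  have e : coeff = fun g => (mat g 0 0)⁻¹ ^ 3 * ((π / 2 : ℝ) : ℂ) := funext coeff_eq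
  rw [e]
  have hc : Continuous (fun g : SU11 => mat g 0 0) :=
    (continuous_apply 0).comp ((continuous_apply 0).comp
      (continuous_subtype_val.comp continuous_subtype_val))
  have hne : ∀ g : SU11, mat g 0 0 ≠ 0 := fun g h => by
    have := normSq_sub_normSq g
    rw [show ((g : Matrix.SpecialLinearGroup (Fin 2) ℂ) : Matrix (Fin 2) (Fin 2) ℂ) 0 0 = mat g 0 0
      from rfl, h, map_zero] at this
    linarith [Complex.normSq_nonneg (mat g 0 1)]
  exact ((hc.inv₀ hne).pow 3).mul continuous_const

/-! ### The printed formula in Cartan coordinates -/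

/-- **The printed formula** `|⟨π(g) f, f⟩| = ‖f‖² cosh(η/2)^{-3}` (S4 l. 82) for the explicit model:
at `g = s(tanh t · e^{iθ}) · rot u` (`t > 0`, `η = 2t`), `|coeff g| = (π/2) · cosh(t)^{-3}` with
`π/2 = ⟨1, 1⟩ = ‖1‖²`. -/
theorem norm_coeff_cartan (t θ : ℝ) (ht : 0 < t) (u : Circle) :
    ‖coeff (fib ((Real.tanh t : ℂ) * ((Real.cos θ : ℂ) + (Real.sin θ : ℂ) * Complex.I), u))‖ =
      π / 2 * Real.cosh t ^ (-(3 : ℝ)) := by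
  have h := norm_coeff_sq (fib ((Real.tanh t : ℂ) * ((Real.cos θ : ℂ) + (Real.sin θ : ℂ) * Complex.I), u))
  rw [← coeffPow_two_eq_coeffSq, coeffPow_cartan 2 t θ ht u] at h
  have hc : 0 < Real.cosh t := Real.cosh_pos t
  have h2 : (π / 2 * Real.cosh t ^ (-(3 : ℝ))) ^ 2 = (π / 2) ^ 2 * Real.cosh t ^ (-(3 * (2 : ℝ))) := by
    rw [mul_pow, ← Real.rpow_natCast (Real.cosh t ^ (-(3 : ℝ))) 2, ← Real.rpow_mul hc.le]
    norm_num
  rw [← h2] at h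
  exact (sq_eq_sq₀ (norm_nonneg _) (by positivity)).mp h

/-- The same in Rühl's variable `η = 2t`: `|⟨π(g) 1, 1⟩| = ‖1‖² cosh(η/2)^{-3}`. -/
theorem norm_coeff_cartan_eta (η θ : ℝ) (hη : 0 < η) (u : Circle) :
    ‖coeff (fib ((Real.tanh (η / 2) : ℂ) * ((Real.cos θ : ℂ) + (Real.sin θ : ℂ) * Complex.I), u))‖ =
      ‖pairing 3 lowest lowest‖ * Real.cosh (η / 2) ^ (-(3 : ℝ)) := by
  rw [norm_coeff_cartan (η / 2) θ (by positivity) u, pairing_lowest_lowest_three, Complex.norm_real,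
    Real.norm_eq_abs, abs_of_pos (by positivity)]

/-! ### Orthogonality of the `K`-types -/

/-- The pairing is hermitian: `⟨f₂, f₁⟩_k = conj ⟨f₁, f₂⟩_k`. -/
theorem pairing_conj_symm (k : ℕ) (f₁ f₂ : ℂ → ℂ) :
    pairing k f₂ f₁ = (starRingEnd ℂ) (pairing k f₁ f₂) := by
  unfold pairing
  rw [← integral_conj]
  congr 1
  ext z
  simp only [map_mul, Complex.conj_conj, Complex.conj_ofReal]
  ring

/-- `u^{k+2m} · (u⁻¹)^{k+2n} = u^{2(m-n)}` for `n ≤ m`. -/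
lemma pow_mul_inv_pow_eq {u : ℂ} (hu : u ≠ 0) (k n m : ℕ) (h : n ≤ m) :
    u⁻¹ ^ (k + 2 * n) * u ^ (k + 2 * m) = u ^ (2 * (m - n)) := by
  obtain ⟨d, rfl⟩ := Nat.exists_eq_add_of_le h
  rw [show k + 2 * (n + d) = (k + 2 * n) + 2 * d by ring, pow_add u (k + 2 * n) (2 * d),
    ← mul_assoc, inv_pow, inv_mul_cancel₀ (pow_ne_zero _ hu), one_mul, Nat.add_sub_cancel_left]

/-- **Orthogonality of distinct `K`-types** (`n < m`): `⟨zⁿ, zᵐ⟩_k = 0` (`k ≥ 2`) — unitarity of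
`π_k(rot u)` for `u = e^{iπ/(2(m-n))}` gives `⟨zⁿ, zᵐ⟩ = u^{2(m-n)} ⟨zⁿ, zᵐ⟩ = -⟨zⁿ, zᵐ⟩`. -/
theorem pairing_monomial_eq_zero_of_lt (k : ℕ) (hk : 2 ≤ k) {n m : ℕ} (hnm : n < m) :
    pairing k (fun w => w ^ n) (fun w => w ^ m) = 0 := by
  set d : ℕ := m - n with hd
  have hdn : d ≠ 0 := (Nat.sub_pos_of_lt hnm).ne'
  have hd0 : (d : ℝ) ≠ 0 := by exact_mod_cast hdn
  have hd0c : (d : ℂ) ≠ 0 := by exact_mod_cast hdn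
  set u : Circle := Circle.exp (π / (2 * d)) with hu
  have key := pairing_act_act k hk (rot u) (fun w => w ^ n) (fun w => w ^ m)
  have e1 : ∀ z ∈ ball (0 : ℂ) 1, act k (rot u) (fun w => w ^ n) z =
      ((u : ℂ)⁻¹) ^ (k + 2 * n) * z ^ n := fun z _ => act_rot_monomial k n u z
  have e2 : ∀ z ∈ ball (0 : ℂ) 1, act k (rot u) (fun w => w ^ m) z =
      ((u : ℂ)⁻¹) ^ (k + 2 * m) * z ^ m := fun z _ => act_rot_monomial k m u z
  rw [pairing_congr e1 e2, pairing_smul_left, pairing_smul_right, map_pow, map_inv₀,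
    ← Circle.coe_inv_eq_conj, Circle.coe_inv, inv_inv, ← mul_assoc,
    pow_mul_inv_pow_eq (Circle.coe_ne_zero u) k n m hnm.le] at key
  -- `u ^ (2 d) = exp(2d · π/(2d) · I) = exp(π I) = -1`
  have hu2 : (u : ℂ) ^ (2 * d) = -1 := by
    rw [hu, Circle.coe_exp, ← Complex.exp_nat_mul]
    push_cast
    rw [show ((2 : ℂ) * d) * ((π : ℂ) / (2 * d) * Complex.I) = π * Complex.I by
      field_simp, Complex.exp_pi_mul_I]
  rw [← hd, hu2, neg_one_mul] at key
  -- `P = -P ⇒ P = 0`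
  have : (2 : ℂ) * pairing k (fun w => w ^ n) (fun w => w ^ m) = 0 := by
    linear_combination (-1 : ℂ) * key
  exact (mul_eq_zero.mp this).resolve_left two_ne_zero

/-- **Orthogonality of distinct `K`-types**: `⟨zⁿ, zᵐ⟩_k = 0` for all `n ≠ m` (`k ≥ 2`). -/
theorem pairing_monomial_eq_zero (k : ℕ) (hk : 2 ≤ k) {n m : ℕ} (hnm : n ≠ m) :
    pairing k (fun w => w ^ n) (fun w => w ^ m) = 0 := by
  rcases lt_or_gt_of_ne hnm with h | h
  · exact pairing_monomial_eq_zero_of_lt k hk h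
  · rw [pairing_conj_symm, pairing_monomial_eq_zero_of_lt k hk h, map_zero]

variable [MeasurableSpace Circle] [BorelSpace Circle]

/-- **Square-integrability**: `|coeff|²` is integrable against every Haar measure of `SU(1,1)`. -/
theorem integrable_norm_coeff_sq (μ : Measure SU11) [IsHaarMeasure μ] :
    Integrable (fun g => ‖coeff g‖ ^ 2) μ := by
  rw [show (fun g => ‖coeff g‖ ^ 2) = fun g => (π / 2) ^ 2 * coeffSq g from funext norm_coeff_sq]
  exact (integrable_coeffSq μ).const_mul _

/-- **The `L²`-integral against every Haar measure**:
`c • ∫_G |⟨π₃(g) 1, 1⟩|² dμ = (π/2)² · π/2`, `c = haarScalarFactor ν μ > 0`. -/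
theorem integral_norm_coeff_sq (μ : Measure SU11) [IsHaarMeasure μ] :
    (haarScalarFactor (nu haarCircle) μ : ℝ) • ∫ g, ‖coeff g‖ ^ 2 ∂μ = (π / 2) ^ 2 * (π / 2) := by
  have h := integral_coeffSq μ
  rw [smul_eq_mul] at h
  rw [show (fun g => ‖coeff g‖ ^ 2) = fun g => (π / 2) ^ 2 * coeffSq g from funext norm_coeff_sq,
    integral_const_mul, smul_eq_mul, mul_left_comm, h]

/-- **Schur orthogonality for the explicit model against `μ_R = ν/π`**:
`∫_G |⟨π₃(g) 1, 1⟩|² dμ_R = |⟨1, 1⟩|² / 2 = ‖1‖⁴ / d(π₃⁺)` with the formal degree `d(π₃⁺) = 2`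
(S4 l. 83). -/
theorem integral_norm_coeff_sq_ruhl :
    ∫ g, ‖coeff g‖ ^ 2 ∂ruhl = ‖pairing 3 lowest lowest‖ ^ 2 / 2 := by
  rw [show (fun g => ‖coeff g‖ ^ 2) = fun g => (π / 2) ^ 2 * coeffSq g from funext norm_coeff_sq,
    integral_const_mul, integral_coeffSq_ruhl, pairing_lowest_lowest_three, Complex.norm_real,
    Real.norm_eq_abs, abs_of_pos (by positivity)]
  ring

/-- The same with the explicit value: `∫_G |⟨π₃(g) 1, 1⟩|² dμ_R = π² / 8`. -/
theorem integral_norm_coeff_sq_ruhl' : ∫ g, ‖coeff g‖ ^ 2 ∂ruhl = π ^ 2 / 8 := by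
  rw [integral_norm_coeff_sq_ruhl, pairing_lowest_lowest_three, Complex.norm_real, Real.norm_eq_abs,
    abs_of_pos (by positivity)]
  ring

end Summit.Ventures.HodgeRepro2.T5BergmanCoefficientL2
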